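import Mathlib
import Literature.Computability.AlgebraicComplexity.OrbitClosureWeights
import Literature.Computability.AlgebraicComplexity.MultiplicityObstructionsProofs
import Literature.Computability.Complexity.OccurrenceObstructionsBIP
import Summits.ValiantsHypothesis.ValiantsHypothesis.Theorems.GeneratorObstructionsGenInheritanceBase

/-!
# `GeneratorObstructions.GenInheritance` (stmt-ValiantsHypothesis-11659) — helper file 2:
inheritance of generator types along a placement of letters

The inheritance theorem for the algebra of highest-weight vectors (`U`-invariants) of coordinate
rings of orbit closures, in the form needed by the route GeneratorObstructions: let `k` have
characteristic zero, `f ∈ k[x_σ]` a nonzero form of degree `m ≠ 0`, `κ : σ → τ` an injection of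
finite linearly ordered sets of letters, and `γ_χ(f) = dim (HWV_χ(k[Δ_m f]) / decomposables)`.
If `γ_χ(f) ≠ 0` then `γ_{χ'}(rename κ f) ≠ 0` for a weight `χ'` of `GL_τ` of the same size
(`exists_size_eq_and_finrank_ne_zero_rename`).

Proof. (1) Reduce to `ι : σ → τ` strictly monotone onto an upper set (final segment,
`exists_strictMono_isUpperSet`): `rename κ f` and `rename ι f` lie in one `GL_τ`-orbit, so their
coordinate rings are canonically and equivariantly isomorphic (helper file 1). (2) For such `ι`
the pull-back `Φ : k[Δ_m f] → k[Δ_m (ι f)]` along the projection killing the letters off `ι(σ)` is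
an injective algebra map (helper file 1) under which an upper triangular `b ∈ GL_τ` acts through
its `σ`-block (`coordSubst_rename_degIdxMap` of the tree's `NotViaSaturationsChowProofs`), so
`Φ(HWV_χ) ⊆ HWV_{ext χ}`, `ext χ` = `χ` extended by zero; conversely every highest-weight vector
of `k[Δ_m (ι f)]` of weight `ext χ` lifts to `k[Sym^m k^τ]` (complete reducibility,
`map_highestWeightSpace_eq_of_surjective`) where, by torus weights
(`monWeight_eq_of_mem_weightSpace_coordRep`), it is a polynomial in the coordinates of the
`ι`-monomials, i.e. a renamed highest-weight vector of `k[Sym^m k^σ]`; hence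
`Φ(HWV_χ) = HWV_{ext χ}` — the inheritance theorem of BLMW 2011 §5.4 / Landsberg 2017 §8.4.1 for
highest-weight vectors. (3) Occurring weights are entrywise `≤ 0`
(`nonpos_and_exists_size_eq_of_hasHighestWeight_orbitCoordRep`), so every splitting
`ext χ = ψ₁ + ψ₂` into occurring weights comes from `σ`, and indecomposability pulls back along
`Φ` (`not_le_decomposable_of_map_eq`, helper file 1).

References: Bürgisser–Landsberg–Manivel–Weyman, SIAM J. Comput. 40 (2011) §5.4 (inheritance);
Landsberg, *Geometry and Complexity Theory* (2017) §8.4.1; Bürgisser–Hüttenhain–Ikenmeyer 2017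
§1 (2), §3 (inheritance of highest-weight vectors, tree file `NotViaSaturationsChowProofs`).
No new definitions. [folklore]
-/

namespace Summit.ValiantsHypothesis.ValiantsHypothesis.Theorems.GenInheritance

open MvPolynomial
open Literature.NumberTheory.DiophantineGeometry Literature.Computability.AlgebraicComplexity
  Literature.Computability.Complexity Literature.Barriers.ValiantsHypothesis

-- `Summit.ValiantsHypothesis.ValiantsHypothesis.…` is the tree's mandated single-conjunct layout (Sub = Summit).
set_option linter.dupNamespace false

section Weights

variable {k : Type*} [Field k] {σ τ : Type*} [Fintype σ] [LinearOrder σ] [Fintype τ] [LinearOrder τ]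
  {ι : σ → τ} {m : ℕ}

/-- **Torus weight vectors of `k[Sym^m (k^τ)]` are sums of monomials of that torus weight**: over
an infinite field, if `F` lies in the weight space of weight `ψ` of `coordRep τ k m`, every
monomial in the support of `F` has torus weight `monWeight s = ψ` (compare coefficients in
`t · F = ψ(t) F` and use the linear independence of torus characters,
`eq_zero_of_sum_mul_weightChar_eq_zero`). Fulton–Harris §15.5 (weight decomposition). [folklore] -/
theorem monWeight_eq_of_mem_weightSpace_coordRep [Infinite k] {ψ : Weight τ}
    {F : MvPolynomial (DegIdx τ m) k} (hF : F ∈ weightSpace (coordRep τ k m) ψ)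
    {s : DegIdx τ m →₀ ℕ} (hs : s ∈ F.support) : monWeight s = ψ := by
  classical
  by_contra hne
  -- coefficient comparison at `s` in `t · F = ψ(t) F`
  have key : ∀ t : GL τ k, IsDiagonalGL t →
      weightChar (monWeight s) t * coeff s F = weightChar ψ t * coeff s F := by
    intro t ht
    have h := hF t ht
    rw [coordRep_apply] at h
    have hexp : coordSubst m t F =
        ∑ u ∈ F.support, weightChar (monWeight u) t • monomial u (coeff u F) := by
      conv_lhs => rw [← F.support_sum_monomial_coeff, map_sum]
      exact Finset.sum_congr rfl fun u _ => coordSubst_monomial_of_isDiagonalGL ht u _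
    have hc := congrArg (coeff s) h
    rw [hexp, coeff_sum, coeff_smul, smul_eq_mul] at hc
    simp only [coeff_smul, coeff_monomial, smul_eq_mul, mul_ite, mul_zero, Finset.sum_ite_eq',
      if_pos hs] at hc
    exact hc
  -- independence of the two characters `monWeight s ≠ ψ`
  have hV : ∀ t : GL τ k, IsDiagonalGL t →
      ∑ v ∈ ({monWeight s, ψ} : Finset (Weight τ)),
        (if v = monWeight s then coeff s F else -coeff s F) * weightChar v t = 0 := by
    intro t ht
    rw [Finset.sum_pair hne, if_pos rfl, if_neg (fun h => hne h.symm), mul_comm (coeff s F),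
      key t ht]
    ring
  have h0 := eq_zero_of_sum_mul_weightChar_eq_zero _ _ hV (monWeight s) (Finset.mem_insert_self _ _)
  rw [if_pos rfl] at h0
  exact (mem_support_iff.mp hs) h0

/-- **A torus weight vector of weight supported on `ι(σ)` is a polynomial in the coordinates of
the `ι`-monomials**: if `F ∈ k[Sym^m (k^τ)]` has weight `χ` extended by zero along the injection
`ι`, then `F = rename (degIdxMap ι) F₀` for some `F₀ ∈ k[Sym^m (k^σ)]` (each monomial of `F` has
torus weight vanishing off `ι(σ)`, so its coordinates `X_E` only involve monomials `E` in the
`ι`-letters). [folklore] -/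
theorem exists_rename_degIdxMap_eq [Infinite k] (hι : Function.Injective ι) {χ : Weight σ}
    {F : MvPolynomial (DegIdx τ m) k}
    (hF : F ∈ weightSpace (coordRep τ k m) (Function.extend ι χ 0)) :
    ∃ F₀ : MvPolynomial (DegIdx σ m) k, rename (degIdxMap hι) F₀ = F := by
  classical
  apply exists_rename_eq_of_vars_subset_range F _ (degIdxMap_injective hι)
  intro E hE
  rw [Finset.mem_coe, mem_vars_iff_mem_support] at hE
  obtain ⟨s, hs, hEs⟩ := hE
  have hw := monWeight_eq_of_mem_weightSpace_coordRep hF hs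
  have hsub : (↑E.1.support : Set τ) ⊆ Set.range ι := by
    intro x hx
    by_contra hxr
    have h0 : Function.extend ι χ (0 : τ → ℤ) x = 0 :=
      (Function.extend_apply' _ _ _ (fun ⟨j, hj⟩ => hxr ⟨j, hj⟩)).trans rfl
    have hx0 := congrFun hw x
    rw [monWeight_apply, h0, neg_eq_zero, Nat.cast_eq_zero, Finset.sum_eq_zero_iff] at hx0
    have h1 := hx0 E hEs
    rcases mul_eq_zero.mp h1 with h2 | h2
    · exact (Finsupp.mem_support_iff.mp hEs) h2
    · exact (Finsupp.mem_support_iff.mp (Finset.mem_coe.mp hx)) h2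
  obtain ⟨e, he⟩ := exists_eq_degIdxMap hι hsub
  exact ⟨e, he⟩

/-- **Inheritance of highest-weight vectors of `k[Sym^m]`, converse direction.** For `ι` strictly
monotone onto an upper set of letters, every highest-weight vector of `k[Sym^m (k^τ)]` whose
weight is `χ` extended by zero along `ι` is the renaming of a highest-weight vector of
`k[Sym^m (k^σ)]` of weight `χ` (the renaming exists by `exists_rename_degIdxMap_eq`; it is a
highest-weight vector because an upper triangular `b ∈ GL_σ` extends to an upper triangular
`c ∈ GL_τ` acting on renamed polynomials through its block `b`, `coordSubst_rename_degIdxMap`).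
Together with the tree's `rename_mem_highestWeightSpace_coordRep`:
`HWV_{ext χ}(k[Sym^m k^τ]) = ι(HWV_χ(k[Sym^m k^σ]))`. BLMW 2011 §5.4 (inheritance). [folklore] -/
theorem exists_rename_eq_of_mem_highestWeightSpace_coordRep [Infinite k] (hι : StrictMono ι)
    (hup : IsUpperSet (Set.range ι)) {χ : Weight σ} {F : MvPolynomial (DegIdx τ m) k}
    (hF : F ∈ highestWeightSpace (coordRep τ k m) (Function.extend ι χ 0)) :
    ∃ F₀ ∈ highestWeightSpace (coordRep σ k m) χ, rename (degIdxMap hι.injective) F₀ = F := by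
  obtain ⟨F₀, rfl⟩ :=
    exists_rename_degIdxMap_eq hι.injective (highestWeightSpace_le_weightSpace _ _ hF)
  refine ⟨F₀, fun b hb => ?_, rfl⟩
  obtain ⟨c, hc, hcb, -⟩ := exists_gl_isUpperTriangular_extend (k := k) hι b hb
  have hblock : upperBlock hι hup c hc = b := upperBlock_eq_of_extend hι hup hc hcb
  apply rename_injective _ (degIdxMap_injective hι.injective)
  have h := hF c hc
  rw [coordRep_apply, coordSubst_rename_degIdxMap hι hup c hc, hblock,
    ← weightChar_upperBlock hι hup χ c hc, hblock] at h
  rw [coordRep_apply, map_smul]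
  exact h

omit [LinearOrder σ] in
/-- **Splittings of an inherited weight come from `σ`.** Over an infinite field, if weights
`ψ₁`, `ψ₂` occurring in coordinate rings of orbit closures (hence entrywise `≤ 0`,
`nonpos_and_exists_size_eq_of_hasHighestWeight_orbitCoordRep`) add up to a weight extended by zero
along `ι`, then `ψ₁` vanishes off `ι(σ)`, i.e. `ψ₁` is `ψ₁ ∘ ι` extended by zero. [folklore] -/
theorem extend_comp_eq_of_add_eq_extend [Infinite k] (hι : Function.Injective ι)
    {f₁ f₂ : MvPolynomial τ k} {χ : Weight σ} {ψ₁ ψ₂ : Weight τ}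
    (h₁ : HasHighestWeight (orbitCoordRep f₁ m) ψ₁) (h₂ : HasHighestWeight (orbitCoordRep f₂ m) ψ₂)
    (hsum : ψ₁ + ψ₂ = Function.extend ι χ 0) : Function.extend ι (ψ₁ ∘ ι) 0 = ψ₁ := by
  funext x
  by_cases hx : ∃ j, ι j = x
  · obtain ⟨j, rfl⟩ := hx
    rw [hι.extend_apply, Function.comp_apply]
  · rw [Function.extend_apply' _ _ _ hx, Pi.zero_apply]
    have hn1 := (nonpos_and_exists_size_eq_of_hasHighestWeight_orbitCoordRep f₁ h₁).1 x
    have hn2 := (nonpos_and_exists_size_eq_of_hasHighestWeight_orbitCoordRep f₂ h₂).1 x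
    have h3 := congrFun hsum x
    rw [Pi.add_apply, Function.extend_apply' _ _ _ hx, Pi.zero_apply] at h3
    omega

omit [Fintype σ] [LinearOrder σ] [Fintype τ] [LinearOrder τ] in
/-- Extension by zero along an injection is additive on weights. [folklore] -/
theorem extend_add (hι : Function.Injective ι) (a b : Weight σ) :
    Function.extend ι (a + b) (0 : τ → ℤ) = Function.extend ι a 0 + Function.extend ι b 0 := by
  funext x
  by_cases hx : ∃ j, ι j = x
  · obtain ⟨j, rfl⟩ := hx
    rw [Pi.add_apply, hι.extend_apply, hι.extend_apply, hι.extend_apply, Pi.add_apply]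
  · rw [Pi.add_apply, Function.extend_apply' _ _ _ hx, Function.extend_apply' _ _ _ hx,
      Function.extend_apply' _ _ _ hx, Pi.zero_apply, add_zero]

omit [Fintype σ] [LinearOrder σ] [Fintype τ] [LinearOrder τ] in
/-- Extension by zero along an injection is injective on weights. [folklore] -/
theorem extend_injective (hι : Function.Injective ι) :
    Function.Injective fun χ : Weight σ => Function.extend ι χ (0 : τ → ℤ) := by
  intro a b h
  funext j
  have h1 := congrFun h (ι j)
  simp only [hι.extend_apply] at h1
  exact h1

omit [LinearOrder σ] [LinearOrder τ] in
/-- Extension by zero preserves the size of a weight. [folklore] -/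
theorem size_extend (hι : Function.Injective ι) (χ : Weight σ) :
    Weight.size (Function.extend ι χ (0 : τ → ℤ)) = Weight.size χ := by
  rw [Weight.size, Weight.size, sum_eq_sum_app hι (fun x => Function.extend ι χ (0 : τ → ℤ) x)
    fun x hx => by rw [Function.extend_apply' _ _ _ (fun ⟨j, hj⟩ => hx ⟨j, hj⟩), Pi.zero_apply]]
  exact Finset.sum_congr rfl fun j _ => hι.extend_apply _ _ _

end Weights

section Upper

variable {k : Type*} [Field k] {σ τ : Type*} [Fintype σ] [LinearOrder σ] [Fintype τ] [LinearOrder τ]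
  {ι : σ → τ} {m : ℕ}

/-- **The pull-back `Φ : k[Δ_m[f]] → k[Δ_m[ι f]]` exists**: for a nonzero form `f` of degree `m`
over an infinite field, renaming along `degIdxMap ι` carries `I(GL_σ · f)` into `I(GL_τ · ι(f))`
(`rename_mem_orbitVanishingIdeal`), hence descends to an algebra map of the coordinate rings of the
orbit closures. BLMW 2011 §5.4. [folklore] -/
theorem exists_algHom_rename [Infinite k] (hι : Function.Injective ι) {f : MvPolynomial σ k}
    (hf : f.IsHomogeneous m) (hf0 : f ≠ 0) :
    ∃ Φ : OrbitCoordRing f m →ₐ[k] OrbitCoordRing (rename ι f) m,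
      ∀ F, Φ (Ideal.Quotient.mk _ F) = Ideal.Quotient.mk _ (rename (degIdxMap hι) F) :=
  ⟨Ideal.quotientMapₐ (orbitVanishingIdeal (rename ι f) m) (rename (degIdxMap hι))
    (fun F hF => by
      rw [Ideal.mem_comap]
      exact rename_mem_orbitVanishingIdeal hι hf hf0 hF), fun _ => rfl⟩

/-- `Φ` is injective (`rename_mem_orbitVanishingIdeal_iff`: a function on `Δ[f]` vanishing after
renaming on `GL_τ · ι(f)` vanishes on `GL_σ · f`). BHI 2017 §1 (2) (restriction of regular
functions). [folklore] -/
theorem injective_of_apply_mk_eq [Infinite k] (hι : Function.Injective ι) {f : MvPolynomial σ k}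
    (hf : f.IsHomogeneous m) (hf0 : f ≠ 0)
    (Φ : OrbitCoordRing f m →ₐ[k] OrbitCoordRing (rename ι f) m)
    (hΦ : ∀ F, Φ (Ideal.Quotient.mk _ F) = Ideal.Quotient.mk _ (rename (degIdxMap hι) F)) :
    Function.Injective Φ := by
  rw [injective_iff_map_eq_zero]
  intro x hx
  obtain ⟨F, rfl⟩ := Ideal.Quotient.mk_surjective x
  rw [hΦ, Ideal.Quotient.eq_zero_iff_mem, rename_mem_orbitVanishingIdeal_iff hι hf hf0] at hx
  exact Ideal.Quotient.eq_zero_iff_mem.mpr hx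

/-- **Inheritance of highest-weight vectors of the coordinate rings** (characteristic zero): for
`ι` strictly monotone onto an upper set of letters, `Φ` maps the highest-weight space `HWV_χ` of
`k[Δ_m[f]]` ONTO the highest-weight space `HWV_{ext χ}` of `k[Δ_m[ι f]]`, `ext χ` = `χ` extended by
zero. `⊆`: an upper triangular `b ∈ GL_τ` acts on renamed classes through its block
(`coordSubst_rename_degIdxMap`, `weightChar_upperBlock`); `⊇`: a highest-weight vector of the
quotient lifts to one of `k[Sym^m (k^τ)]` (complete reducibility,
`map_highestWeightSpace_eq_of_surjective`), which is a renamed highest-weight vector of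
`k[Sym^m (k^σ)]` (`exists_rename_eq_of_mem_highestWeightSpace_coordRep`). This is the
inheritance theorem BLMW 2011 §5.4 / Landsberg 2017 §8.4.1 for the algebra of highest-weight
vectors. [folklore] -/
theorem map_highestWeightSpace_eq_of_apply_mk_eq [CharZero k] (hι : StrictMono ι)
    (hup : IsUpperSet (Set.range ι)) {f : MvPolynomial σ k}
    (Φ : OrbitCoordRing f m →ₐ[k] OrbitCoordRing (rename ι f) m)
    (hΦ : ∀ F, Φ (Ideal.Quotient.mk _ F) = Ideal.Quotient.mk _ (rename (degIdxMap hι.injective) F))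
    (χ : Weight σ) :
    (highestWeightSpace (orbitCoordRep f m) χ).map Φ.toLinearMap =
      highestWeightSpace (orbitCoordRep (rename ι f) m) (Function.extend ι χ 0) := by
  apply le_antisymm
  · rintro _ ⟨x, hx, rfl⟩ b hb
    obtain ⟨F, rfl⟩ := Ideal.Quotient.mk_surjective x
    change orbitCoordRep _ m b (Φ (Ideal.Quotient.mk _ F)) = _ • Φ (Ideal.Quotient.mk _ F)
    rw [hΦ, orbitCoordRep_apply, orbitCoordSubst_mk, coordSubst_rename_degIdxMap hι hup b hb, ← hΦ,
      ← orbitCoordSubst_mk, ← orbitCoordRep_apply, hx _ (isUpperTriangular_upperBlock hι hup b hb),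
      map_smul, weightChar_upperBlock, hΦ]
  · intro y hy
    have hsurj : Function.Surjective (mkIntertwiningMap (rename ι f) m) :=
      Ideal.Quotient.mk_surjective
    rw [← map_highestWeightSpace_eq_of_surjective (mkIntertwiningMap (rename ι f) m) hsurj
      (isSemisimpleRepresentation_coordRep m) (Function.extend ι χ 0)] at hy
    obtain ⟨F, hF, rfl⟩ := Submodule.mem_map.mp hy
    obtain ⟨F₀, hF₀, rfl⟩ := exists_rename_eq_of_mem_highestWeightSpace_coordRep hι hup hF
    refine ⟨Ideal.Quotient.mk _ F₀, ?_, ?_⟩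
    · exact highestWeightSpace_le_comap_intertwiningMap (mkIntertwiningMap f m) χ hF₀
    · change Φ (Ideal.Quotient.mk _ F₀) = mkIntertwiningMap (rename ι f) m (rename _ F₀)
      rw [hΦ, mkIntertwiningMap_apply]

/-- **Inheritance of generator types along an upper embedding of letters** (characteristic zero,
`m ≠ 0`): for `ι` strictly monotone onto an upper set and a nonzero form `f` of degree `m`, if the
highest-weight vectors of weight `χ` of `k[Δ_m[f]]` are not all sums of products of highest-weight
vectors of complementary nonzero weights (`γ_χ(f) ≠ 0`), then the same holds for `k[Δ_m[ι f]]` at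
the weight `χ` extended by zero (`γ_{ext χ}(ι f) ≠ 0`). Assembled from
`map_highestWeightSpace_eq_of_apply_mk_eq`, `extend_comp_eq_of_add_eq_extend` and the abstract
pull-back `not_le_decomposable_of_map_eq`. [folklore] -/
theorem finrank_ne_zero_rename_of_strictMono [CharZero k] (hι : StrictMono ι)
    (hup : IsUpperSet (Set.range ι)) {f : MvPolynomial σ k} (hf : f.IsHomogeneous m) (hf0 : f ≠ 0)
    (hm : m ≠ 0) (χ : Weight σ)
    (h : Module.finrank k (↥(highestWeightSpace (orbitCoordRep f m) χ) ⧸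
      Submodule.comap (highestWeightSpace (orbitCoordRep f m) χ).subtype
        (⨆ p : Weight σ × Weight σ, ⨆ (_ : p.1 + p.2 = χ ∧ p.1 ≠ 0 ∧ p.2 ≠ 0),
          highestWeightSpace (orbitCoordRep f m) p.1 *
            highestWeightSpace (orbitCoordRep f m) p.2)) ≠ 0) :
    Module.finrank k (↥(highestWeightSpace (orbitCoordRep (rename ι f) m) (Function.extend ι χ 0)) ⧸
      Submodule.comap (highestWeightSpace (orbitCoordRep (rename ι f) m)
        (Function.extend ι χ 0)).subtype
        (⨆ p : Weight τ × Weight τ, ⨆ (_ : p.1 + p.2 = Function.extend ι χ 0 ∧ p.1 ≠ 0 ∧ p.2 ≠ 0),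
          highestWeightSpace (orbitCoordRep (rename ι f) m) p.1 *
            highestWeightSpace (orbitCoordRep (rename ι f) m) p.2)) ≠ 0 := by
  haveI := finiteDimensional_highestWeightSpace_orbitCoordRep_holds f hm χ
  haveI := finiteDimensional_highestWeightSpace_orbitCoordRep_holds (rename ι f) hm
    (Function.extend ι χ 0)
  rw [finrank_quotient_comap_subtype_ne_zero_iff] at h ⊢
  obtain ⟨Φ, hΦ⟩ := exists_algHom_rename hι.injective hf hf0
  exact not_le_decomposable_of_map_eq (orbitCoordRep f m) (orbitCoordRep (rename ι f) m) Φ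
    (injective_of_apply_mk_eq hι.injective hf hf0 Φ hΦ) (fun χ => Function.extend ι χ 0)
    (extend_add hι.injective) (extend_injective hι.injective)
    (map_highestWeightSpace_eq_of_apply_mk_eq hι hup Φ hΦ) χ
    (fun ψ₁ ψ₂ hsum h₁ h₂ => ⟨ψ₁ ∘ ι, extend_comp_eq_of_add_eq_extend hι.injective h₁ h₂ hsum⟩) h

end Upper

section Placement

variable {k : Type*} [Field k] {σ τ : Type*} [Fintype σ] [LinearOrder σ] [Fintype τ] [LinearOrder τ]
  {m : ℕ}

omit [Fintype σ] [Fintype τ] in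
/-- **Final segments.** If `|σ| ≤ |τ|` for finite linear orders, there is a strictly monotone
`ι : σ → τ` onto an upper set (the greatest `|σ|` letters of `τ`). [folklore] -/
theorem exists_strictMono_isUpperSet [Fintype σ] [Fintype τ]
    (hle : Fintype.card σ ≤ Fintype.card τ) :
    ∃ ι : σ → τ, StrictMono ι ∧ IsUpperSet (Set.range ι) := by
  set s := Fintype.card σ with hs
  set t := Fintype.card τ with ht
  let eσ : σ ≃o Fin s := (Fintype.orderIsoFinOfCardEq σ hs.symm).symm
  let eτ : τ ≃o Fin t := (Fintype.orderIsoFinOfCardEq τ ht.symm).symm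
  let sh : Fin s → Fin t := fun i => ⟨(i : ℕ) + (t - s), by omega⟩
  have hsh : StrictMono sh := fun a b hab => by
    change (a : ℕ) + (t - s) < (b : ℕ) + (t - s)
    exact Nat.add_lt_add_right hab _
  refine ⟨fun x => eτ.symm (sh (eσ x)), fun a b hab => eτ.symm.strictMono (hsh (eσ.strictMono hab)),
    ?_⟩
  rintro x y hxy ⟨a, rfl⟩
  have h1 : sh (eσ a) ≤ eτ y := by
    have := eτ.monotone hxy
    rwa [OrderIso.apply_symm_apply] at this
  have h2 : t - s ≤ (eτ y : ℕ) := le_trans (Nat.le_add_left _ _) h1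
  refine ⟨eσ.symm ⟨(eτ y : ℕ) - (t - s), by omega⟩, ?_⟩
  change eτ.symm (sh (eσ (eσ.symm _))) = y
  rw [OrderIso.apply_symm_apply, OrderIso.symm_apply_eq]
  exact Fin.ext (by change (eτ y : ℕ) - (t - s) + (t - s) = (eτ y : ℕ); omega)

/-- **Inheritance of generator types along any placement of letters** (characteristic zero,
`m ≠ 0`): for an injection `κ : σ → τ` and a nonzero form `f` of degree `m` in the letters `σ`, every
weight `χ` with `γ_χ(f) ≠ 0` (a generator type of the algebra of highest-weight vectors of
`k[Δ_m[f]]`) yields a weight `χ'` of the same size with `γ_{χ'}(rename κ f) ≠ 0`: `χ' = χ`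
extended by zero along a final-segment embedding `ι` (`finrank_ne_zero_rename_of_strictMono`),
transported from `rename ι f` to `rename κ f`, which lie in one `GL_τ`-orbit
(`rename_mem_glOrbit_rename_of_injective`, `finrank_ne_zero_of_orbitVanishingIdeal_eq`).
BLMW 2011 §5.4 / Landsberg 2017 §8.4.1 (inheritance), for `𝔪/𝔪²` of the covariant algebra.
[folklore] -/
theorem exists_size_eq_and_finrank_ne_zero_rename [CharZero k] (κ : σ → τ)
    (hκ : Function.Injective κ) {f : MvPolynomial σ k} (hf : f.IsHomogeneous m) (hf0 : f ≠ 0)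
    (hm : m ≠ 0) (χ : Weight σ)
    (h : Module.finrank k (↥(highestWeightSpace (orbitCoordRep f m) χ) ⧸
      Submodule.comap (highestWeightSpace (orbitCoordRep f m) χ).subtype
        (⨆ p : Weight σ × Weight σ, ⨆ (_ : p.1 + p.2 = χ ∧ p.1 ≠ 0 ∧ p.2 ≠ 0),
          highestWeightSpace (orbitCoordRep f m) p.1 *
            highestWeightSpace (orbitCoordRep f m) p.2)) ≠ 0) :
    ∃ χ' : Weight τ, Weight.size χ' = Weight.size χ ∧
      Module.finrank k (↥(highestWeightSpace (orbitCoordRep (rename κ f) m) χ') ⧸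
        Submodule.comap (highestWeightSpace (orbitCoordRep (rename κ f) m) χ').subtype
          (⨆ p : Weight τ × Weight τ, ⨆ (_ : p.1 + p.2 = χ' ∧ p.1 ≠ 0 ∧ p.2 ≠ 0),
            highestWeightSpace (orbitCoordRep (rename κ f) m) p.1 *
              highestWeightSpace (orbitCoordRep (rename κ f) m) p.2)) ≠ 0 := by
  obtain ⟨ι, hι, hup⟩ :=
    exists_strictMono_isUpperSet (σ := σ) (τ := τ) (Fintype.card_le_of_injective κ hκ)
  refine ⟨Function.extend ι χ 0, size_extend hι.injective χ, ?_⟩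
  exact finrank_ne_zero_of_orbitVanishingIdeal_eq
    (orbitVanishingIdeal_eq_of_mem_glOrbit
      (rename_mem_glOrbit_rename_of_injective κ ι hκ hι.injective f) m) hm _
    (finrank_ne_zero_rename_of_strictMono hι hup hf hf0 hm χ h)

end Placement

end Summit.ValiantsHypothesis.ValiantsHypothesis.Theorems.GenInheritance
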